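import Summits.HodgeConjecture.HodgeConjecture.Theorems.R90S6LatticeInvPolarity        -- L1 FILE 2 (`relPos_qsInvolution`, `qsInvolution_inv`); brings FILE 1 `relPos`, ★ W7-f, ★ CartanUnique, the bridge
import Literature.NumberTheory.Automorphic.UnitaryLatticeTreeTypeTwoGram               -- ★ `UnitaryLatticeTree.v_det_eq_one_of_isIntMatrix_inv` (`GL_N(𝒪)` has unit determinant)
import HarnessLib

/-!
# R90 · S6 «Ch. 14.1–14.5 stable TF» — card L1 (row E1.4.4.2.2, layer 1), FILE 3: THE DETERMINANT OF THE RELATIVE POSITION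
# `|det(g⁻¹g′)| = q^{−Σ inv(g,g′)}`, `Σ_i inv(Λ, Λ′)_i = ord det g′ − ord det g`, `|det Θ_σ(g)| = |det g|⁻¹`, and the PARITY LAW `Σ_i inv(Λ, Λ^♯)_i = 2·(−ord det g) ∈ 2ℤ`
# (`Theorems/R90S6LatticeInvDeterminant.lean`)

Cell `hodgecm-mathlib`, crux H413 (`stmt-HodgeConjecture-24833`), route `HCCMUnconditional`; programme R90-TF, section S6 (base `R90-C14`, dealer R90-C14-plan (g2)), seat
R90-C14-p10 (g0); card **L1**, head (14) «parity ∕ type constraints of `d(Λ) = inv(Λ, Λ^♯)`» (DEAL 2026-09-05T00:12:58Z l.6040 (iii); «(14) LAST, may slip to a FILE 3» «=» l.6140).  Lane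
`--kind proof --supports stmt-HodgeConjecture-24833` (helper; THEOREMS ONLY: no definition, no instance, no notation, no named fact, no `sorry`; one private summation lemma).  Imports: L1
FILE 2 `Theorems.R90S6LatticeInvPolarity` + ★ `Literature…UnitaryLatticeTreeTypeTwoGram` + HarnessLib; no `Cruxes` import.

THE MATHEMATICS (Macdonald V §2; Kottwitz 1986 §3).  In the `Valued K ℤᵐ⁰` currency (`v ϖ = exp(−1)`, so `v(ϖ^m) = exp(−m)`, ★ `CartanUnique.v_uniformizer_zpow`), the valuation of a
determinant is the exponential of MINUS the sum of exponents: `v(det ϖ^a) = exp(−Σ a_i)`; `GL_N(𝒪)` has `v(det) = 1` (★ `v_det_eq_one_of_isIntMatrix_inv`); hence on the shell `K ϖ^a K`,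
`v(det x) = exp(−Σ a_i)`, and for the relative position: **`v(det(g⁻¹g′)) = exp(−Σ_i relPos_i)`**, i.e. **`Σ_i inv(Λ, Λ′)_i = log v(det g) − log v(det g′)`** (the index `[Λ : Λ′]` in
valuation terms).  The involution satisfies **`v(det Θ_σ g) = v(det g)⁻¹`** (`det w⁰ · det w⁰ = det 1`, `det ᵗ(σg)⁻¹ = σ(det g)⁻¹`, `v ∘ σ = v`), so the «distance to the unitary tree»
`d(Λ) = inv(Λ, Λ^♯)` has **`Σ_i d_i = 2·log v(det g)`**, in particular **`Σ_i d_i` IS EVEN** — the parity constraint of head (14) (at `N = 3`: the hyperspecial∕type-two alternation of the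
`U(3)` tree seen from `GL₃`).
* §1 `v_det_zpowDiagGL`, `v_det_eq_one_of_mem_glInt`, `v_det_eq_exp_of_shell`;
* §2 **`v_det_inv_mul_eq_exp_neg_sum_relPos`**, **`sum_relPos_eq_log_sub_log`**;
* §3 **`v_det_qsInvolution`**, **`sum_relPos_self_qsInvolution_eq_two_mul`**, **`even_sum_relPos_self_qsInvolution`**.
HONEST LABEL: valuation bookkeeping; proves no printed global statement, discharges no citation; count-neutral helper until E1.4.4.2.x consumes it.  HC_CM is proved only modulo the 7
printed citations (2 remaining named inputs: hLiu418 = stmt-HodgeConjecture-24832, h413 = stmt-HodgeConjecture-24833) until rung 0 closes.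

## References
* [Macdonald1995] I. G. Macdonald, *Symmetric Functions and Hall Polynomials*, 2nd ed. (1995), Ch. V §2 (2.2)–(2.6) (`|det x| = q^{−Σλ_i}` on `K π^λ K`).
* [Kottwitz1986BaseChangeUnits] R. Kottwitz, *Base change for unit elements of Hecke algebras*, Compositio Math. 60 (1986), §3.
* [Serre1979] J.-P. Serre, *Local Fields*, GTM 67 (1979), Ch. I §1 (`x = π^n u`).
-/
set_option autoImplicit false
-- the mandated namespace repeats the single-problem summit's segment (`HodgeConjecture.HodgeConjecture`)
set_option linter.dupNamespace false

noncomputable section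

open scoped Matrix MatrixGroups Valued WithZero
open Literature.NumberTheory.Automorphic Literature.NumberTheory.Automorphic.HermitianLattice Literature.NumberTheory.Automorphic.UnitaryLatticeTree

namespace Summit.HodgeConjecture.HodgeConjecture.R90.S6

/-! ## §1 Determinants on the Cartan shells -/

section Shell

variable {K : Type*} [Field K] [Valued K ℤᵐ⁰] {N : ℕ} {ϖ : K}

/-- `∏ exp(f i) = exp(Σ f i)` in `ℤᵐ⁰`. [cite: Serre1979, Ch. I §1] -/
private theorem prod_exp_eq_exp_sum {ι : Type*} (s : Finset ι) (f : ι → ℤ) :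
    ∏ i ∈ s, WithZero.exp (f i) = WithZero.exp (∑ i ∈ s, f i) := by
  induction s using Finset.cons_induction with
  | empty => simp
  | cons a s ha ih => rw [Finset.prod_cons, Finset.sum_cons, ih, WithZero.exp_add]

/-- **`v(det ϖ^a) = exp(−Σ_i a_i)`** for `v ϖ = exp(−1)` (★ `CartanUnique.v_uniformizer_zpow`, `det diag = ∏`). [cite: Macdonald1995, Ch. V §2 (2.2)] [cite: Serre1979, Ch. I §1] -/
theorem v_det_zpowDiagGL (hvϖ : Valued.v ϖ = WithZero.exp (-1 : ℤ)) (hϖ0 : ϖ ≠ 0) (a : Fin N → ℤ) :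
    Valued.v ((zpowDiagGL hϖ0 a : GL (Fin N) K) : Matrix (Fin N) (Fin N) K).det = WithZero.exp (-(∑ i, a i)) := by
  rw [coe_zpowDiagGL, Matrix.det_diagonal, map_prod]
  simp_rw [CartanUnique.v_uniformizer_zpow hvϖ]
  rw [prod_exp_eq_exp_sum, Finset.sum_neg_distrib]

variable [ValuativeRel K] [(Valued.v : Valuation K ℤᵐ⁰).Compatible]

/-- **`GL_N(𝒪)` has unit determinant**: `v(det k) = 1` for `k ∈ glInt N K` (★ `v_det_eq_one_of_isIntMatrix_inv` through ★ W7-f (i) `mem_glInt_iff_isIntMatrix`). [cite: Serre1979, Ch. I §1] -/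
theorem v_det_eq_one_of_mem_glInt {k : GL (Fin N) K} (hk : k ∈ glInt N K) : Valued.v (k : Matrix (Fin N) (Fin N) K).det = 1 := by
  rw [mem_glInt_iff_isIntMatrix] at hk
  exact v_det_eq_one_of_isIntMatrix_inv hk.1 hk.2

/-- **On the shell `GL_N(𝒪) ϖ^a GL_N(𝒪)` the determinant has valuation `exp(−Σ a_i)`**: `k₁ x k₂ = ϖ^a ⟹ v(det x) = exp(−Σ_i a_i)`. [cite: Macdonald1995, Ch. V §2 (2.2)] -/
theorem v_det_eq_exp_of_shell (hvϖ : Valued.v ϖ = WithZero.exp (-1 : ℤ)) (hϖ0 : ϖ ≠ 0) {a : Fin N → ℤ} {x k₁ k₂ : GL (Fin N) K}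
    (hk₁ : k₁ ∈ glInt N K) (hk₂ : k₂ ∈ glInt N K) (h : k₁ * x * k₂ = zpowDiagGL hϖ0 a) :
    Valued.v (x : Matrix (Fin N) (Fin N) K).det = WithZero.exp (-(∑ i, a i)) := by
  have hdet := congrArg (fun y : GL (Fin N) K => Valued.v (y : Matrix (Fin N) (Fin N) K).det) h
  simp only [Units.val_mul, Matrix.det_mul, map_mul, v_det_eq_one_of_mem_glInt hk₁, v_det_eq_one_of_mem_glInt hk₂, one_mul, mul_one] at hdet
  rw [hdet, v_det_zpowDiagGL hvϖ]

end Shell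

/-! ## §2 `Σ_i inv(Λ, Λ′)_i` is the valuation of `det(g⁻¹g′)` -/

section Sum

variable {K : Type*} [Field K] [Valued K ℤᵐ⁰] [ValuativeRel K] [(Valued.v : Valuation K ℤᵐ⁰).Compatible] {N : ℕ}
  [IsDiscreteValuationRing (ValuativeRel.valuation K).integer] {ϖ : K} (hϖ : IsUniformizingElement ϖ) (hvϖ : Valued.v ϖ = WithZero.exp (-1 : ℤ))
include hϖ hvϖ

/-- **`v(det(g⁻¹g′)) = exp(−Σ_i relPos hϖ g g′ i)`** (FILE 1 `relPos_spec` + §1). [cite: Macdonald1995, Ch. V §2 (2.6)] -/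
theorem v_det_inv_mul_eq_exp_neg_sum_relPos (g g' : GL (Fin N) K) :
    Valued.v ((g⁻¹ * g' : GL (Fin N) K) : Matrix (Fin N) (Fin N) K).det = WithZero.exp (-(∑ i, relPos hϖ g g' i)) := by
  obtain ⟨-, k₁, hk₁, k₂, hk₂, e⟩ := relPos_spec hϖ g g'
  exact v_det_eq_exp_of_shell hvϖ hϖ.ne_zero hk₁ hk₂ e

/-- **`Σ_i inv(Λ, Λ′)_i = log v(det g) − log v(det g′)`** for `Λ = g·𝒪^N`, `Λ′ = g′·𝒪^N`: the sum of the relative position is the valuation of the determinant ratio (the index of the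
lattices, `[Λ : Λ′]` when `Λ′ ≤ Λ`). [cite: Macdonald1995, Ch. V §2 (2.6)] [cite: Serre1979, Ch. I §1] -/
theorem sum_relPos_eq_log_sub_log (g g' : GL (Fin N) K) :
    ∑ i, relPos hϖ g g' i =
      WithZero.log (Valued.v (g : Matrix (Fin N) (Fin N) K).det) - WithZero.log (Valued.v (g' : Matrix (Fin N) (Fin N) K).det) := by
  have h := v_det_inv_mul_eq_exp_neg_sum_relPos hϖ hvϖ g g'
  rw [Units.val_mul, Matrix.det_mul, map_mul, Matrix.coe_units_inv, Matrix.det_nonsing_inv, Ring.inverse_eq_inv', map_inv₀] at h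
  have hg : Valued.v (g : Matrix (Fin N) (Fin N) K).det ≠ 0 := (Valuation.ne_zero_iff _).2 (Matrix.isUnits_det_units g).ne_zero
  have hg' : Valued.v (g' : Matrix (Fin N) (Fin N) K).det ≠ 0 := (Valuation.ne_zero_iff _).2 (Matrix.isUnits_det_units g').ne_zero
  have hlog := congrArg WithZero.log h
  rw [WithZero.log_mul (inv_ne_zero hg) hg', WithZero.log_inv, WithZero.log_exp] at hlog
  omega

end Sum

/-! ## §3 The involution: `v(det Θ_σ g) = v(det g)⁻¹` and the parity of `Σ_i inv(Λ, Λ^♯)_i` -/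

section Theta

variable {K : Type*} [Field K] [Valued K ℤᵐ⁰] {σ : K →+* K} {N : ℕ}

/-- **`v(det Θ_σ(g)) = v(det g)⁻¹`** for `σ` valuation-preserving (`Θ_σ g = w⁰ ᵗ(σg)⁻¹ w⁰`, `det w⁰ · det w⁰ = det(w⁰w⁰) = 1`, `det ᵗ(σg)⁻¹ = (σ det g)⁻¹`). [cite: Kottwitz1986BaseChangeUnits, §3] -/
theorem v_det_qsInvolution (hvσ : ∀ a, Valued.v (σ a) = Valued.v a) (g : GL (Fin N) K) :
    Valued.v ((UnitaryGroup.qsInvolution σ g : GL (Fin N) K) : Matrix (Fin N) (Fin N) K).det = (Valued.v (g : Matrix (Fin N) (Fin N) K).det)⁻¹ := by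
  have hw : ((weylLong N K : GL (Fin N) K) : Matrix (Fin N) (Fin N) K).det * ((weylLong N K : GL (Fin N) K) : Matrix (Fin N) (Fin N) K).det = 1 := by
    rw [← Matrix.det_mul, ← Units.val_mul, weylLong_mul_self, Units.val_one, Matrix.det_one]
  have hmap : ((g : Matrix (Fin N) (Fin N) K).map σ).det = σ (g : Matrix (Fin N) (Fin N) K).det := by
    rw [← RingHom.mapMatrix_apply, ← RingHom.map_det]
  rw [UnitaryGroup.coe_qsInvolution, Matrix.det_mul, Matrix.det_mul, Matrix.det_transpose, Matrix.det_nonsing_inv, Ring.inverse_eq_inv', hmap,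
    mul_comm (((weylLong N K : GL (Fin N) K) : Matrix (Fin N) (Fin N) K).det) _, mul_assoc, hw, mul_one, map_inv₀, hvσ]

variable [ValuativeRel K] [(Valued.v : Valuation K ℤᵐ⁰).Compatible] [IsDiscreteValuationRing (ValuativeRel.valuation K).integer]
  {ϖ : K} (hϖ : IsUniformizingElement ϖ) (hvϖ : Valued.v ϖ = WithZero.exp (-1 : ℤ))
include hϖ hvϖ

/-- **`Σ_i inv(Λ, Λ^♯)_i = 2·log v(det g)`** (`Λ = g·𝒪^N`, `Λ^♯ = Θ_σ(g)·𝒪^N` by ★ W9-b): §2 with `v(det Θ_σ g) = v(det g)⁻¹`. [cite: Kottwitz1986BaseChangeUnits, §3] [cite: Macdonald1995, Ch. V §2 (2.6)] -/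
theorem sum_relPos_self_qsInvolution_eq_two_mul (hvσ : ∀ a, Valued.v (σ a) = Valued.v a) (g : GL (Fin N) K) :
    ∑ i, relPos hϖ g (UnitaryGroup.qsInvolution σ g) i = 2 * WithZero.log (Valued.v (g : Matrix (Fin N) (Fin N) K).det) := by
  rw [sum_relPos_eq_log_sub_log hϖ hvϖ, v_det_qsInvolution hvσ, WithZero.log_inv]
  ring

/-- **THE PARITY LAW: `Σ_i inv(Λ, Λ^♯)_i` is EVEN** for every full-rank lattice `Λ = g·𝒪^N` — the «distance to the unitary tree» `d(Λ) = relPos hϖ g (Θ_σ g)` has even total degree (at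
`N = 3`: a `GL₃`-lattice and its polar are separated by an even number of elementary steps, the hyperspecial∕type-two alternation). [cite: Kottwitz1986BaseChangeUnits, §3] -/
theorem even_sum_relPos_self_qsInvolution (hvσ : ∀ a, Valued.v (σ a) = Valued.v a) (g : GL (Fin N) K) :
    Even (∑ i, relPos hϖ g (UnitaryGroup.qsInvolution σ g) i) :=
  ⟨WithZero.log (Valued.v (g : Matrix (Fin N) (Fin N) K).det), by rw [sum_relPos_self_qsInvolution_eq_two_mul hϖ hvϖ hvσ, two_mul]⟩

end Theta

end Summit.HodgeConjecture.HodgeConjecture.R90.S6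

end
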